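import Literature.MathematicalPhysics.QuantumFieldTheory.Balaban1983to89.B15Prop1CoerciveEditionNearExt
import Literature.MathematicalPhysics.QuantumFieldTheory.Balaban1983to89.B15Prop1GradientFromNearValueB
import Literature.MathematicalPhysics.QuantumFieldTheory.Balaban1983to89.B15Prop1CarrierStdB
import Literature.MathematicalPhysics.QuantumFieldTheory.Balaban1983to89.Node00.LargeFieldBackgroundCoPOfRecordB

/-!
# `Balaban1983to89.B15Prop1CoerciveEditionNearExtB` — [Balaban1989LargeFieldI] (= [B15]) Prop. 1 (1.77)–(1.78) p. 194 (incl. the last clause), (1.74) p. 192, p. 193; [Balaban1989LargeFieldII] (1.7)–(1.9)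
# p. 358, (1.12)–(1.13), (1.15) p. 359; [Balaban1985Variational] (= [15]) (5) p. 278, Prop. 9 p. 309; [Balaban1988Convergent] (= [III]) (2.12)–(2.13) pp. 256–257; [Balaban1984PropagatorsII]
# (= [II]) (2.3) p. 224: PROPOSITION 1 [IV] WITH ITS ANALYTIC-EXTENSION CLAUSE AT PRINT'S (1.74) OBJECT **OVER A BOND-LEVEL DATUM**, (Vn)∕(J1)∕(J1ˢ)∕(1.9) LETTERS — the print-datum
# edition of the ONE declaration of `B15Prop1CoerciveEditionNearExt` that N12's junction of record uses (`…_atZSeqCoPRecord_ofNearValue_ofCoercive_nearExt`) (THEOREMS ONLY)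

statement-level skeleton of published theorems with citation tags; proofs where landed; nothing here is a claim about
the Yang–Mills mass gap

Cell `pub-ymgap` (HUMAN RULINGS D-0062 ∕ D-0149), lane `pub-ymgap-dag-n12-c` g35 (R134 seat (a), N12 = [B15], s1); `--kind proof --supports` K1⁹ `stmt-QuantumFields-27364`;
count-neutral.  THEOREMS ONLY (0 `def`, 0 `instance`, 0 `sorry`).  (E1) variant (iii-b), class (β) of the lane's census-by-declaration (bus [DAGN12C-G35]).  WHY THIS IS THIN: the lane's g21–g28
road is built on FUNCTION-GENERIC layers (`…OfFun` modules: `B15Prop1CoerciveOfFun.exists_domain_prop1Printed_lfVarOn_ofFun_intrinsic_analytic_ofCoercive`,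
`B15Prop1GradientFromNearValue.hJ_of_nearValue_nearExt`), whose statements are datum-free; the record heads only INSTANTIATE them at print's function.  So the bond-datum edition is the
parent's 12-line proof with the function `fun177stdB (Node00.bgMSCoPOfRecordB …) ν.M₁ bd (Z i) (k i)` (S2b, F), its gauge invariance `B15Eq177ValueInvarianceB.fun177stdB_bgOfRecordB_gaugeAct`
(range clause `hbd`), the near value of `bgKZstdB`, and the dichotomy `B15Prop1GradientFromNearValueB.fun177stdB_dichotomy` (level-`0` clause `hbd0`); the carrier conclusion is
`InstOn.stdB …` (J) by `rfl`.  Binders: the parent's VERBATIM, with `bd`, `hbd`, `hbd0` ADDED and `hk0` dropped (subsumed by `hbd0`); (J1) `hGj`, (J1ˢ) `hGjS`, (1.9) `hcoer`, (Vn) `hVn` read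
the bond-datum function.

HONESTY GUARD (director-ym №338 (5)).  PURELY ADDITIVE: the (b)-keyed parent stays landed and true on its own text; no displayed premise of any consumer is deleted or weakened; the new
clauses are displayed.  Nothing of [15] ∕ [LF-II] asserted: (J1), (J1ˢ), (1.9), (Vn) remain HYPOTHESES.

WHAT IS HERE.  ★★★ `exists_domain_prop1Printed_lfVarOn_stdB_su2_box_intrinsic_analytic_atZSeqCoPRecordB_ofNearValue_ofCoercive_nearExt`.

HONEST SCOPE.  Junction bookkeeping; count-neutral; N12 NOT discharged; K0⁷ ∕ K1⁹ NOT closed; one finite 𝕋⁴ programme at fixed ε — nothing continuum ∕ ℝ⁴ ∕ OS; the Yang–Mills mass gap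
(Clay) is NOT proved by any of this.

References: [B15] = [Balaban1989LargeFieldI] (1.74) p.192, p.193, Prop. 1 (1.77)–(1.78) p.194; [Balaban1989LargeFieldII] (1.7)–(1.9), (1.11) p.358, (1.12)–(1.13), (1.15) p.359; [15] =
[Balaban1985Variational] (2), (5), (6) p.278, Thm 1 (8) p.279, Prop. 9 p.309; [III] = [Balaban1988Convergent] p.255, (2.12)–(2.13) pp.256–257; [II] = [Balaban1984PropagatorsII] (2.3) p.224.
-/

noncomputable section

open Set Finset Metric
open scoped BigOperators Matrix RealInnerProductSpace Real InnerProductSpace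

namespace Literature.MathematicalPhysics.QuantumFieldTheory.Balaban1983to89.B15Prop1CoerciveEditionNearExt

open B15DeterminingSets B15DeterminingSetsB GaugeField B16Sect1Backgrounds B15Prop1Carrier B8Eq17ClassAkV1 BlockAveraging
open B15Prop1SliceTaylorCalculus B15Prop1IntrinsicAnalyticExt B15Prop1ParametricZeroBranch B15Prop1LocalLettersOfFun B15Prop1IntrinsicOfFun
open B15Prop1GradientFromNearValue
open B15Prop1CoerciveOfFun
open B15Prop1AnalyticExtClause (cplxVec cplxSlice cplxSlice_apply norm_cplxSlice norm_cplxVec reSlice anExt anExt_antitone)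
open B15Prop1ChartCalculusSU2 (E3)
open T4CubeChartGnomonic (SU2)
open B15Prop1ChartSU2 (su2Chart)
open B15Prop1SliceCoordinates (GaugeSlice ιA freeBonds norm_ιA_apply_le)
open T4AxialGaugeSmallField (castSite boxPlaqs)
open B6BondElimination (unitVec)
open B16Eq18Proof (box mem_box)
open B15Extension193 (extend)
open B15ShellGauge193 (shellGauge)
open B14.Eq213MaximalDomains (side)
open B14.Eq213DetSet B14.Eq216Concrete B15Sect1Instances B15Eq177GaugeInvariance B15Eq177ValueInvariance B15Eq177ValueInvarianceCoDiv B16Sect1Wilson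
open B14.Eq22Determines (blockIter IsBlockUnion)
open Literature.MathematicalPhysics.QuantumFieldTheory.BalabanImbrieJaffe1984to88.BIJ85Eq453GaugeField
open T4Continuum
open Classical

/-! ## §1  The (Vn)∕(J1)∕(J1ˢ)∕(1.9) head of the `_ofCoercive` chain over a bond datum -/

section AtRecordB

/-- ★★★ **PROPOSITION 1 [IV] WITH ITS ANALYTIC-EXTENSION CLAUSE AT PRINT'S (1.74) OBJECT OVER A BOND-LEVEL DATUM, WITH THE NEAR-FIELD VALUE LETTER (Vn)** — per instance the BOND-LEVEL
background of record `Node00.bgMSCoPOfRecordB F 2 ν Kt (k i) (maxDomT ν.M₁ (Z i))` (S2b: the class `regMSCoPOfRecord` = [15] (2) on the support of record, print's, unchanged; the solution map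
on the bonds of the family `bd`, print's [II] (2.3) datum at `bd := lamDatumP`); twin of `…_atZSeqCoPRecord_ofNearValue_ofCoercive_nearExt` with the parent's binders VERBATIM plus the family
`bd`, its range clause `hbd` and its level-`0` pinning clause `hbd0` (`hk0` dropped).  WHAT A CONSUMER SUPPLIES: (J1) `hGj`, (J1ˢ) `hGjS`, (1.9) `hcoer`, (Vn) `hVn` (all reading the
bond-datum function `fun177stdB … ν.M₁ bd …` ∕ its near value), `hcJ'`, `hfar`, structure, `hcl := Subsingleton.elim _ _`.  Proof: the parent's, over the function-generic
`exists_domain_prop1Printed_lfVarOn_ofFun_intrinsic_analytic_ofCoercive` and `hJ_of_nearValue_nearExt`, with `fun177stdB_bgOfRecordB_gaugeAct` and `fun177stdB_dichotomy`.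
[cite: Balaban1989LargeFieldI, (1.74) p.192, Prop. 1 (1.77)–(1.78) p.194 (incl. the last clause), p.193; Balaban1988Convergent, p.255, (2.12)–(2.13) pp.256–257;
Balaban1985Variational, (2),(5),(6) p.278, Thm 1 (8) p.279, Prop. 9 p.309; Balaban1989LargeFieldII, (1.7)–(1.9) p.358, (1.11) p.358, (1.12)–(1.13) p.359; Balaban1984PropagatorsII, (2.3) p.224] -/
theorem exists_domain_prop1Printed_lfVarOn_stdB_su2_box_intrinsic_analytic_atZSeqCoPRecordB_ofNearValue_ofCoercive_nearExt {F : T4Family}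
    (ν : Node00.Stage7Numerics) (Kt : ℕ) (hd3 : 3 ≤ (F.P Kt).d) (h0 : 0 < (F.P Kt).d) {ι : Type}
    [hdec : ∀ j, DecidableEq (PBond (F.P Kt) j)] (hcl : hdec = fun _ a b => Classical.propDecidable (a = b))
    (Z Λ : ι → Set (Site (F.P Kt) 0)) (k : ι → ℕ) (M : ι → ℝ) (hk : ∀ i, k i ≤ (F.P Kt).m + (F.P Kt).K)
    -- the bond-datum family ([II] (2.3): `lamDatumP`; reading (b): `genSetDatumP`), empty above the standing range, with the level-`0` pinning clause
    (bd : ℕ → (ℕ → Set (Site (F.P Kt) 0)) → BDetSet (F.P Kt))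
    (hbd : ∀ i j, (F.P Kt).m + (F.P Kt).K < j → bd (k i) (maxDomT ν.M₁ (Z i)) j = ∅)
    (hbd0 : ∀ i (b : PBond (F.P Kt) 0), b.src ∉ maxDomT ν.M₁ (Z i) 1 → b.tgt ∉ maxDomT ν.M₁ (Z i) 1 → b ∈ bd (k i) (maxDomT ν.M₁ (Z i)) 0)
    (eR : ι → ℝ) (heR : ∀ i, 0 < eR i)
    (T : ∀ i, Finset (PBond (F.P Kt) (k i)))
    (lo hi : ι → Fin (F.P Kt).d → ℤ) (n : ι → ℕ) (hn : ∀ i κ, hi i κ ≤ lo i κ + n i) (hN : ∀ i, n i + 2 < (F.P Kt).sitesPerDir (k i))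
    (hbox : ∀ i, pts (k i) (Λ i) = (castSite '' Set.Icc (lo i) (hi i) : Set (Site (F.P Kt) (k i))))
    (hZ : ∀ i, (boxPlaqs (lo i - 1) (hi i + 1) : Set (Plaq (F.P Kt) (k i))) ⊆ plaqsInside (pts (k i) (Z i)))
    (hTG0 : ∀ i, T i = (box (fun κ => (hi i κ - lo i κ + 1).toNat) (lo i)).image fun x =>
      (⟨castSite (x - unitVec ⟨0, h0⟩), ⟨0, h0⟩⟩ : PBond (F.P Kt) (k i)))
    (hN5 : ∀ i κ, ((hi i κ - lo i κ + 1).toNat : ℤ) + 5 < (F.P Kt).sitesPerDir (k i))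
    (ext : ∀ i, GaugeField (F.P Kt) (k i) SU2 → GaugeField (F.P Kt) (k i) SU2)
    (hext : ∀ i Vk, ext i Vk = extend (pts (k i) (Λ i)) (shellGauge Vk (lo i) (hi i)) Vk)
    (hlohi : ∀ i, lo i ≤ hi i)
    {γ cJ bx : ℝ} (hγ : 0 < γ) (hcJ : 0 ≤ cJ) (hbx : 0 ≤ bx)
    (hbxM : ∀ i, 12 * ((F.P Kt).d : ℝ) * ((n i : ℝ) + 2) ^ 2 ≤ bx * (M i) ^ 2)
    {R 𝓐 𝓐S : ι → ℝ} (hM : ∀ i, 1 ≤ (M i)) (hR : ∀ i, 0 < R i) (h𝓐 : ∀ i, 0 ≤ 𝓐 i)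
    -- (J1) the JOINT holomorphic extension of print's function in the datum perturbation and the field
    (hGj : ∀ i Vk, PlaqSmallOn (plaqsInside (pts (k i) (Z i ∩ (Λ i)ᶜ))) (eR i) Vk →
      ∃ 𝒢 : VecField (F.P Kt) (k i) (EuclideanSpace ℂ (Fin 3)) × VecField (F.P Kt) (k i) (EuclideanSpace ℂ (Fin 3)) → ℂ,
        DifferentiableOn ℂ 𝒢 (ball 0 (R i)) ∧
        (∀ z ∈ ball (0 : VecField (F.P Kt) (k i) (EuclideanSpace ℂ (Fin 3)) × VecField (F.P Kt) (k i) (EuclideanSpace ℂ (Fin 3))) (R i), ‖𝒢 z‖ ≤ 𝓐 i) ∧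
        ∀ p B' : VecField (F.P Kt) (k i) E3, ‖p‖ < R i → ‖B'‖ < R i →
          𝒢 (cplxVec p, cplxVec B') =
            ((fun177stdB (Node00.bgMSCoPOfRecordB F 2 ν Kt (k i) (maxDomT ν.M₁ (Z i))) ν.M₁ bd (Z i) (k i)
              (expMul su2Chart B' (ext i (expMul su2Chart p Vk))) : ℝ) : ℂ))
    -- (J1ˢ) the JOINT holomorphic extension of the NEAR value of (1.77), bounded by `𝓐S i` — census U3: the near count's currency; served by (J0′) via
    -- `B15Prop1NearValueOfMinimiserFamilyB `jointHolomorphic_nearValue_bgMSCoPOfRecordB_of_minimiserFamily`` with `𝓐S i = #plaqsOf(Ω₁(Z_i))·(1+8𝓐₀ i⁴)`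
    (hGjS : ∀ i Vk, PlaqSmallOn (plaqsInside (pts (k i) (Z i ∩ (Λ i)ᶜ))) (eR i) Vk →
      ∃ 𝒢S : VecField (F.P Kt) (k i) (EuclideanSpace ℂ (Fin 3)) × VecField (F.P Kt) (k i) (EuclideanSpace ℂ (Fin 3)) → ℂ,
        DifferentiableOn ℂ 𝒢S (ball 0 (R i)) ∧
        (∀ z ∈ ball (0 : VecField (F.P Kt) (k i) (EuclideanSpace ℂ (Fin 3)) × VecField (F.P Kt) (k i) (EuclideanSpace ℂ (Fin 3))) (R i), ‖𝒢S z‖ ≤ 𝓐S i) ∧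
        ∀ p B' : VecField (F.P Kt) (k i) E3, ‖p‖ < R i → ‖B'‖ < R i →
          𝒢S (cplxVec p, cplxVec B') =
            ((wilsonLoc ((plaqsOf (maxDomT ν.M₁ (Z i) 1)).indicator fun _ => (1 : ℝ))
              (bgKZstdB (Node00.bgMSCoPOfRecordB F 2 ν Kt (k i) (maxDomT ν.M₁ (Z i))) ν.M₁ bd (Z i) (k i)
                (expMul su2Chart B' (ext i (expMul su2Chart p Vk)))) : ℝ) : ℂ))
    -- (L2) = (1.9) p.358 AS THE LETTER: coercivity of the slice Hessian `D(∇ sliceFn)(0)` at `eR`-regular data (dag-n12-c's `hcoer`; replaces `{γ₀} h17 hsm hγle`)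
    (hcoer : ∀ i Vk, PlaqSmallOn (plaqsInside (pts (k i) (Z i ∩ (Λ i)ᶜ))) (eR i) Vk → ∀ X : GaugeSlice (pts (k i) (Λ i)) (T i) E3,
      γ / (M i) ^ 5 * ‖X‖ ^ 2 ≤ ⟪X, (fderiv ℝ (rGrad (pts (k i) (Λ i)) (T i)
              (sliceFn (pts (k i) (Λ i)) (T i)
                (fun177stdB (Node00.bgMSCoPOfRecordB F 2 ν Kt (k i) (maxDomT ν.M₁ (Z i))) ν.M₁ bd (Z i) (k i)) (ext i Vk))) 0) X⟫)
    -- the geometric letter: the k-blocks over the bonds meeting `Λ^{(k)}` lie inside `Ω₁(Z)` (print: `Λ` deep inside `Z`)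
    (hfar : ∀ i (b : PBond (F.P Kt) 0), b.src ∉ maxDomT ν.M₁ (Z i) 1 →
      (⟨blockIter (k i) b.src, b.dir⟩ : PBond (F.P Kt) (k i)) ∉ bondsOf (pts (k i) (Λ i)))
    -- (Vn) the NEAR-FIELD part of (1.77) at the extended regular datum is small (replaces (L3))
    {cA : ℝ}
    (hVn : ∀ i ε Vk, 0 < ε → ε ≤ eR i → PlaqSmallOn (plaqsInside (pts (k i) (Z i ∩ (Λ i)ᶜ))) ε Vk →
      wilsonLoc ((plaqsOf (maxDomT ν.M₁ (Z i) 1)).indicator fun _ => (1 : ℝ))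
        (bgKZstdB (Node00.bgMSCoPOfRecordB F 2 ν Kt (k i) (maxDomT ν.M₁ (Z i))) ν.M₁ bd (Z i) (k i) (ext i Vk)) ≤ cA * ε ^ 2)
    (hcJ' : ∀ i, 2 * cA * eR i / R i + 2 * 𝓐S i / (R i * eR i) ≤ cJ)
    : ∃ a₁ : ι → ℝ, (∀ i, 0 < a₁ i) ∧
      B15.Prop1Printed (lfVarOn su2Chart fun i =>
        InstOn.stdB (Node00.bgMSCoPOfRecordB F 2 ν Kt (k i) (maxDomT ν.M₁ (Z i))) ν.M₁ bd (Z i) (Λ i) (k i) (M i) (a₁ i)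
          (anExt (pts (k i) (Λ i)) (T i)
            (fun177stdB (Node00.bgMSCoPOfRecordB F 2 ν Kt (k i) (maxDomT ν.M₁ (Z i))) ν.M₁ bd (Z i) (k i)) (ext i)
            (min (1 / 2) (min (R i / 8) (γ / (M i) ^ 5 * (R i / 2) ^ 2 / (48 * (4 * 𝓐 i / R i + 1))))))) := by
  subst hcl
  exact exists_domain_prop1Printed_lfVarOn_ofFun_intrinsic_analytic_ofCoercive hd3 h0 Z Λ k M
    (fun i => fun177stdB (Node00.bgMSCoPOfRecordB F 2 ν Kt (k i) (maxDomT ν.M₁ (Z i))) ν.M₁ bd (Z i) (k i))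
    (fun i u V => fun177stdB_bgOfRecordB_gaugeAct (Node00.avOfRecord F 2 Kt)
      (gaugeAct_mem_regMSCoPOfRecord ν Kt (k i) (maxDomT ν.M₁ (Z i))) ν.M₁ bd (Z i) (hk i) (hbd i) u V)
    eR heR T lo hi n hn hN hbox hZ hTG0 hN5 ext hext hlohi hγ hcJ hbx hbxM hM hR h𝓐 hGj hcoer
    (hJ_of_nearValue_nearExt Z Λ k
      (fun i => fun177stdB (Node00.bgMSCoPOfRecordB F 2 ν Kt (k i) (maxDomT ν.M₁ (Z i))) ν.M₁ bd (Z i) (k i))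
      (fun i V => wilsonLoc ((plaqsOf (maxDomT ν.M₁ (Z i) 1)).indicator fun _ => (1 : ℝ))
        (bgKZstdB (Node00.bgMSCoPOfRecordB F 2 ν Kt (k i) (maxDomT ν.M₁ (Z i))) ν.M₁ bd (Z i) (k i) V))
      (fun _ _ => wilsonLoc_nonneg _ _ fun p => Set.indicator_nonneg (fun _ _ => zero_le_one) p) eR heR T ext hR hGj hGjS
      (fun i Vk _ => fun177stdB_dichotomy (Node00.avOfRecord F 2 Kt)
        (Node00.regMSCoPOfRecord F 2 ν Kt (k i) (maxDomT ν.M₁ (Z i))) ν.M₁ bd (hk i) (T i) (hbd0 i) (hfar i) (ext i Vk))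
      hVn hcJ')

end AtRecordB

end Literature.MathematicalPhysics.QuantumFieldTheory.Balaban1983to89.B15Prop1CoerciveEditionNearExt

end
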